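import Mathlib
import Summits.Ventures.PercRepro2.TypedBHKHalf

/-!
# The half-conditioned typed BHK 1.4 for arbitrary cluster events
(blind cell PercRepro2, p5 g2, 2026-08-25; sub-claim S4 / row 2′TB-U, `proofs/P5-TB14.md` §1)

`TypedBHKHalf.pairCount_half` is the single-vertex case (`A = {b ∈ C(a₁)}`, `B = {o ∈ C(a₂)}`).
The same wall-flip argument gives the statement for an ARBITRARY event `𝒜` of the cluster of `a₁`
(no monotonicity needed: the wall flip fixes that cluster) and an arbitrary UP-SET event `ℬ` of the
cluster of `a₂` (the second copy's cluster of `a₂` after the wall flip contains the first copy's):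

  `pairCount_half_clusterEvent :  N(Q ∩ {C(a₁) ∈ 𝒜} ∩ {C(a₂) ∈ ℬ}, Ω) ≤ N(Q ∩ {C(a₁) ∈ 𝒜}, {C(a₂) ∈ ℬ})`

— the Bernstein-coefficient form of `P(C(a₂) ∈ ℬ | Q, C(a₁) ∈ 𝒜) ≤ P(C(a₂) ∈ ℬ)` for increasing `ℬ`,
i.e. the half-conditioned form of the all-up-sets row 2′TB-U; unconditional, standard axioms.
-/

namespace Summit.Ventures.PercRepro2

namespace TypedBHKHalf

open CovForm A3InactiveTyped

section Clusters

variable {V : Type*} {E : Type*} [DecidableEq E]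

/-- The cluster of `a₂` of the first copy is contained in the cluster of `a₂` of the second copy of
the wall-flipped configuration (under `Q`). -/
lemma cluster_subset_flipOn_wallFlip (ends : E → Sym2 V) (a₁ : V) (F : Finset E) {y : Config E}
    {a₂ : V} (hQ : ¬ Conn ends y a₁ a₂) :
    cluster ends y a₂ ⊆ cluster ends (flipOn F (wallFlip ends a₁ F y)) a₂ :=
  fun _ hu => conn_flipOn_wallFlip ends a₁ F hQ hu

end Clusters

section ClusterIndicator

variable {V : Type} {E : Type} {R : Type*} [Field R]

/-- `1_{C(v) ∈ 𝒮}` as a function of the configuration. -/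
noncomputable def iCl (ends : E → Sym2 V) (v : V) (𝒮 : Set (Set V)) : Config E → R :=
  fun ω => 𝒮.indicator 1 (cluster ends ω v)

/-- `1_{C(a₁) ∈ 𝒜}` is fixed by the wall flip (the cluster of `a₁` is). -/
lemma iCl_wallFlip [DecidableEq E] (ends : E → Sym2 V) (a₁ : V) (𝒜 : Set (Set V)) (F : Finset E)
    (y : Config E) : (iCl ends a₁ 𝒜 (wallFlip ends a₁ F y) : R) = iCl ends a₁ 𝒜 y := by
  unfold iCl
  rw [cluster_wallFlip]

variable [LinearOrder R] [IsStrictOrderedRing R]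

/-- `0 ≤ 1_{C(v) ∈ 𝒮}`. -/
lemma iCl_nonneg (ends : E → Sym2 V) (v : V) (𝒮 : Set (Set V)) (ω : Config E) :
    0 ≤ (iCl ends v 𝒮 ω : R) :=
  Set.indicator_nonneg (fun _ _ => zero_le_one) _

/-- For an up-set `ℬ`, `1_{C(a₂) ∈ ℬ}` is monotone under cluster inclusion. -/
lemma iCl_le_of_subset (ends : E → Sym2 V) (a₂ : V) {ℬ : Set (Set V)} (hℬ : IsUpperSet ℬ)
    {y w : Config E} (h : cluster ends y a₂ ⊆ cluster ends w a₂) :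
    (iCl ends a₂ ℬ y : R) ≤ iCl ends a₂ ℬ w := by
  unfold iCl
  by_cases hy : cluster ends y a₂ ∈ ℬ
  · rw [Set.indicator_of_mem hy, Set.indicator_of_mem (hℬ h hy)]
    exact le_rfl
  · rw [Set.indicator_of_notMem hy]
    exact Set.indicator_nonneg (fun _ _ => zero_le_one) _

end ClusterIndicator

section Half

variable {V : Type} {E : Type} [Fintype E] [DecidableEq E] {R : Type*} [Field R] [LinearOrder R]
  [IsStrictOrderedRing R]

/-- **The half-conditioned typed BHK 1.4 for cluster events** (THEOREM, unconditional): for every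
finite graph, every profile, roots `a₁, a₂`, every event `𝒜` of `C(a₁)` and every UP-SET event `ℬ`
of `C(a₂)`: `N(Q ∩ {C(a₁) ∈ 𝒜} ∩ {C(a₂) ∈ ℬ}, Ω) ≤ N(Q ∩ {C(a₁) ∈ 𝒜}, {C(a₂) ∈ ℬ})`. -/
theorem pairCount_half_clusterEvent (ends : E → Sym2 V) (a₁ a₂ : V) (𝒜 ℬ : Set (Set V))
    (hℬ : IsUpperSet ℬ) (F : Finset E) (z : Config E) :
    pairCount F z (fun y _ => iQ ends a₁ a₂ y * iCl ends a₁ 𝒜 y * iCl ends a₂ ℬ y :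
        Config E → Config E → R) ≤
      pairCount F z (fun y w => iQ ends a₁ a₂ y * iCl ends a₁ 𝒜 y * iCl ends a₂ ℬ w) := by
  unfold pairCount
  beta_reduce
  have hinv : Function.Involutive (wallFlip ends a₁ F) := fun y => wallFlip_wallFlip ends a₁ F y
  calc
    ∑ y : Config E, (if (∀ e, e ∉ F → y e = z e) then
        (iQ ends a₁ a₂ y : R) * iCl ends a₁ 𝒜 y * iCl ends a₂ ℬ y else 0)
      ≤ ∑ y : Config E, (if (∀ e, e ∉ F → y e = z e) then
        (iQ ends a₁ a₂ y : R) * iCl ends a₁ 𝒜 y *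
          iCl ends a₂ ℬ (flipOn F (wallFlip ends a₁ F y)) else 0) := by
      refine Finset.sum_le_sum fun y _ => ?_
      by_cases hadm : ∀ e, e ∉ F → y e = z e
      · rw [if_pos hadm, if_pos hadm]
        by_cases hQ : Conn ends y a₁ a₂
        · have h0 : (iQ ends a₁ a₂ y : R) = 0 := by
            unfold iQ
            rw [Set.indicator_of_notMem]
            simp only [mem_avoidAll, Finset.mem_singleton, forall_eq, not_not]
            exact conn_symm hQ
          rw [h0]; simp
        · exact mul_le_mul_of_nonneg_left
            (iCl_le_of_subset ends a₂ hℬ (cluster_subset_flipOn_wallFlip ends a₁ F hQ))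
            (mul_nonneg (iQ_nonneg ends a₁ a₂ y) (iCl_nonneg ends a₁ 𝒜 y))
      · rw [if_neg hadm, if_neg hadm]
    _ = ∑ y : Config E, (if (∀ e, e ∉ F → wallFlip ends a₁ F y e = z e) then
        (iQ ends a₁ a₂ (wallFlip ends a₁ F y) : R) * iCl ends a₁ 𝒜 (wallFlip ends a₁ F y) *
          iCl ends a₂ ℬ (flipOn F (wallFlip ends a₁ F y)) else 0) := by
      refine Finset.sum_congr rfl fun y _ => ?_
      rw [iQ_wallFlip, iCl_wallFlip]
      by_cases hadm : ∀ e, e ∉ F → y e = z e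
      · rw [if_pos hadm, if_pos ((wallFlip_admissible_iff ends a₁ F z y).2 hadm)]
      · rw [if_neg hadm, if_neg (fun h => hadm ((wallFlip_admissible_iff ends a₁ F z y).1 h))]
    _ = ∑ y : Config E, (if (∀ e, e ∉ F → y e = z e) then
        (iQ ends a₁ a₂ y : R) * iCl ends a₁ 𝒜 y * iCl ends a₂ ℬ (flipOn F y) else 0) := by
      exact Fintype.sum_equiv hinv.toPerm _ _ (fun y => rfl)

end Half

end TypedBHKHalf

end Summit.Ventures.PercRepro2
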